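import Summits.SmoothPoincare4.SmoothPoincare4.Theorems.SymplecticOrigamiGromovRecognitionRelEndStubFlatCutoffAux

/-!
# Tame cut-off of the bi-foliation chart — `C¹`-decay at infinity along one factor
(stub `stub_flatCutoff` of line `cross-cap-laurent`, crux `GromovRecognitionRelEnd`, item
stmt-SmoothPoincare4-11009; second of four files)

The "Laurent decay" of the line in its qualitative, holomorphy-free form
(`decay_first_factor`, registered helper sub-goal `helper_flatCutoffDecayFirstFactor`): a map
`G : ℝ⁴ → ℝ⁴` fixing `z₁` on `{|z₁| > R₁}` and `z₂` on `{|z₂| > R₁}`, whose `z₂`-component read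
in the inverted chart `u = 1/z₁` extends `C¹` across the axis `u = 0` by the identity
(hypotheses (B3), (B4) of the bi-foliation chart `σ ∘ χ` of the apex), satisfies `G → id` in `C¹`
as `|z₁| → ∞`. Proof: `G - id = k ∘ T` with `T(z₁, z₂) = (1/z₁, z₂)` and
`k(u, z₂) = (0, g(u, z₂) - z₂)` a `C¹` map on the cylinder `{|u| < R₁⁻¹}` that vanishes on the
axis and for `|z₂| > R₁`; uniform continuity of `k`, `Dk` on the compact label set
`{|u| ≤ R₁⁻¹/2, |z₂| ≤ R₁ + 1}` (the flat leaves beyond are exact), `Dk(0, z₂) ∘ ι = 0` and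
`‖DT(w) - ι‖ ≤ 5|z₁|⁻²` give `‖G w - w‖ ≤ ε`, `‖DG(w) - I‖ ≤ ε` for `|z₁| ≥ ρ(ε)`. No rate is
recorded (the line's `O(1/ρ)` needs one more derivative and is not used downstream).

Everything is proved; no definition, no named fact.
-/

noncomputable section

-- the registered namespace `Summit.SmoothPoincare4.SmoothPoincare4.Theorems…` repeats a component
set_option linter.dupNamespace false

open scoped Topology
open Set Filter Metric
open Literature.Geometry.Symplectic.LegendrianDarboux (euclidean_four_ext)

namespace Summit.SmoothPoincare4.SmoothPoincare4.Theorems.GromovRecognitionRelEnd.CrossCapLaurent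

namespace FlatCutoff

/-- Model space `ℝ⁴ = ℂ²` (coordinates `0,1` = `z₁`, `2,3` = `z₂`). -/
local notation "E4" => EuclideanSpace ℝ (Fin 4)
/-- `ℝ² = ℂ`, the coordinate plane of one factor. -/
local notation "E2" => EuclideanSpace ℝ (Fin 2)

/-! ## One-sided `C¹`-decay from smoothness at the wedge -/

/-- **`C¹`-flatness at infinity along the first factor** (the "Laurent decay" of the line, in its
qualitative form). Let `G : ℝ⁴ → ℝ⁴` fix the `z₁`-coordinate on `{|z₁| > R₁}` and the
`z₂`-coordinate on `{|z₂| > R₁}`, and suppose that in the inverted coordinate `u = 1/z₁` the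
`z₂`-component `g(u, z₂)` of `G(1/u, z₂)` extends `C¹` across the axis `u = 0` by `g(0, z₂) = z₂`.
Then `G → id` in `C¹` as `|z₁| → ∞`: for every `ε > 0` there is `ρ` with `‖G w - w‖ ≤ ε` and
`‖DG(w) - I‖ ≤ ε` whenever `|z₁| ≥ ρ`. Proof: `G - id = k ∘ T` with `T(z₁, z₂) = (1/z₁, z₂)` and
`k(u, z₂) = (0, g(u, z₂) - z₂)` a `C¹` map on the cylinder `{|u| < R₁⁻¹}` vanishing on the axis and
for `|z₂| > R₁`; uniform continuity of `k` and `Dk` on the compact `{|u| ≤ R₁⁻¹/2, |z₂| ≤ R₁ + 1}`,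
`Dk(0, z₂) ∘ ι = 0` (`ι` the axis projection) and `‖DT(w) - ι‖ ≤ 5|z₁|⁻²`. [folklore] -/
theorem decay_first_factor {R₁ : ℝ} (hR₁ : 0 < R₁) {G : E4 → E4} {g : E4 → E2}
    (hg : ContDiffOn ℝ 1 g {p : E4 | p 0 ^ 2 + p 1 ^ 2 < R₁⁻¹ ^ 2})
    (hgG : ∀ p q : E4, p 0 ^ 2 + p 1 ^ 2 < R₁⁻¹ ^ 2 → (p 0 ≠ 0 ∨ p 1 ≠ 0) →
      q = G (WithLp.toLp 2
        ![p 0 / (p 0 ^ 2 + p 1 ^ 2), -(p 1) / (p 0 ^ 2 + p 1 ^ 2), p 2, p 3]) →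
      g p = WithLp.toLp 2 ![q 2, q 3])
    (hg0 : ∀ p : E4, p 0 = 0 → p 1 = 0 → g p = WithLp.toLp 2 ![p 2, p 3])
    (hGa : ∀ w : E4, R₁ ^ 2 < w 0 ^ 2 + w 1 ^ 2 → (G w) 0 = w 0 ∧ (G w) 1 = w 1)
    (hGb : ∀ w : E4, R₁ ^ 2 < w 2 ^ 2 + w 3 ^ 2 → (G w) 2 = w 2 ∧ (G w) 3 = w 3) :
    ∀ ε : ℝ, 0 < ε → ∃ ρ : ℝ, 0 < ρ ∧ ∀ w : E4, ρ ^ 2 ≤ w 0 ^ 2 + w 1 ^ 2 →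
      DifferentiableAt ℝ G w ∧ ‖G w - w‖ ≤ ε ∧
        ‖fderiv ℝ G w - ContinuousLinearMap.id ℝ E4‖ ≤ ε := by
  intro ε hε
  obtain ⟨ι, hι, -, hιn⟩ := exists_clm_axis23
  have hιv : ∀ v : E4, (ι v) 0 = 0 ∧ (ι v) 1 = 0 ∧ (ι v) 2 = v 2 ∧ (ι v) 3 = v 3 := fun v => by
    simp [hι]
  -- the cylinder `C₁`, the inversion `T`, the correction `k`
  set C₁ : Set E4 := {p : E4 | p 0 ^ 2 + p 1 ^ 2 < R₁⁻¹ ^ 2} with hC₁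
  have hC₁o : IsOpen C₁ := isOpen_lt (by fun_prop) continuous_const
  set T : E4 → E4 := fun v => WithLp.toLp 2
      ![v 0 / (v 0 ^ 2 + v 1 ^ 2), -(v 1) / (v 0 ^ 2 + v 1 ^ 2), v 2, v 3] with hT
  have hTv : ∀ v : E4, (T v) 0 = v 0 / (v 0 ^ 2 + v 1 ^ 2) ∧
      (T v) 1 = -(v 1) / (v 0 ^ 2 + v 1 ^ 2) ∧ (T v) 2 = v 2 ∧ (T v) 3 = v 3 := fun v => by
    simp [hT]
  set k : E4 → E4 := fun p => WithLp.toLp 2 ![0, 0, (g p) 0 - p 2, (g p) 1 - p 3] with hk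
  have hkv : ∀ p : E4, (k p) 0 = 0 ∧ (k p) 1 = 0 ∧ (k p) 2 = (g p) 0 - p 2 ∧
      (k p) 3 = (g p) 1 - p 3 := fun p => by simp [hk]
  have hkC : ContDiffOn ℝ 1 k C₁ := by
    rw [contDiffOn_euclidean]
    have hg' := contDiffOn_euclidean.1 hg
    intro i
    fin_cases i
    · simpa [hk] using contDiffOn_const
    · simpa [hk] using contDiffOn_const
    · simpa [hk] using (hg' 0).sub (by fun_prop : ContDiff ℝ 1 fun p : E4 => p 2).contDiffOn
    · simpa [hk] using (hg' 1).sub (by fun_prop : ContDiff ℝ 1 fun p : E4 => p 3).contDiffOn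
  -- `k` vanishes on the axis and far out in `z₂`
  have hk0 : ∀ p : E4, p 0 = 0 → p 1 = 0 → k p = 0 := by
    intro p h0 h1
    have hgp := hg0 p h0 h1
    refine euclidean_four_ext ?_ ?_ ?_ ?_
    · simp [(hkv p).1]
    · simp [(hkv p).2.1]
    · simp [(hkv p).2.2.1, hgp]
    · simp [(hkv p).2.2.2, hgp]
  have hkfar : ∀ p ∈ C₁, R₁ ^ 2 < p 2 ^ 2 + p 3 ^ 2 → k p = 0 := by
    intro p hp hfar
    by_cases hax : p 0 = 0 ∧ p 1 = 0
    · exact hk0 p hax.1 hax.2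
    · have hor : p 0 ≠ 0 ∨ p 1 ≠ 0 := by tauto
      have hq := hgG p _ hp hor rfl
      have h23 := hGb (T p) (by rw [(hTv p).2.2.1, (hTv p).2.2.2]; exact hfar)
      rw [(hTv p).2.2.1, (hTv p).2.2.2] at h23
      refine euclidean_four_ext ?_ ?_ ?_ ?_
      · simp [(hkv p).1]
      · simp [(hkv p).2.1]
      · rw [(hkv p).2.2.1, hq]
        simpa [sub_eq_zero] using h23.1
      · rw [(hkv p).2.2.2, hq]
        simpa [sub_eq_zero] using h23.2
  -- `T` is an involution off the axis and maps `{|z₁| > R₁}` into the punctured cylinder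
  have hT01 : ∀ v : E4, v 0 ^ 2 + v 1 ^ 2 ≠ 0 →
      (T v) 0 ^ 2 + (T v) 1 ^ 2 = (v 0 ^ 2 + v 1 ^ 2)⁻¹ := by
    intro v hv
    rw [(hTv v).1, (hTv v).2.1]
    field_simp
  have hTT : ∀ v : E4, v 0 ^ 2 + v 1 ^ 2 ≠ 0 → T (T v) = v := by
    intro v hv
    have h01 := hT01 v hv
    refine euclidean_four_ext ?_ ?_ ?_ ?_
    · rw [(hTv (T v)).1, h01, (hTv v).1]
      field_simp
    · rw [(hTv (T v)).2.1, h01, (hTv v).2.1]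
      field_simp
    · rw [(hTv (T v)).2.2.1, (hTv v).2.2.1]
    · rw [(hTv (T v)).2.2.2, (hTv v).2.2.2]
  have hTC : ∀ v : E4, R₁ ^ 2 < v 0 ^ 2 + v 1 ^ 2 →
      T v ∈ C₁ ∧ ((T v) 0 ≠ 0 ∨ (T v) 1 ≠ 0) := by
    intro v hv
    have hpos : 0 < v 0 ^ 2 + v 1 ^ 2 := (sq_nonneg R₁).trans_lt hv
    refine ⟨?_, ?_⟩
    · show (T v) 0 ^ 2 + (T v) 1 ^ 2 < R₁⁻¹ ^ 2
      rw [hT01 v hpos.ne', inv_pow]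
      exact inv_strictAnti₀ (by positivity) hv
    · by_cases h0 : v 0 = 0
      · right
        have h1 : v 1 ≠ 0 := by
          intro h1; rw [h0, h1] at hpos; simp at hpos
        rw [(hTv v).2.1]
        exact div_ne_zero (neg_ne_zero.2 h1) hpos.ne'
      · left
        rw [(hTv v).1]
        exact div_ne_zero h0 hpos.ne'
  -- `G = id + k ∘ T` on `{|z₁| > R₁}`
  have hGk : ∀ v : E4, R₁ ^ 2 < v 0 ^ 2 + v 1 ^ 2 → G v = v + k (T v) := by
    intro v hv
    have hpos : 0 < v 0 ^ 2 + v 1 ^ 2 := (sq_nonneg R₁).trans_lt hv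
    obtain ⟨hTv', hor⟩ := hTC v hv
    have hq := hgG (T v) _ hTv' hor rfl
    have hTT' : (WithLp.toLp 2 ![(T v) 0 / ((T v) 0 ^ 2 + (T v) 1 ^ 2),
        -((T v) 1) / ((T v) 0 ^ 2 + (T v) 1 ^ 2), (T v) 2, (T v) 3] : E4) = v := hTT v hpos.ne'
    rw [hTT'] at hq
    have h01 := hGa v hv
    refine euclidean_four_ext ?_ ?_ ?_ ?_
    · simp [(hkv (T v)).1, h01.1]
    · simp [(hkv (T v)).2.1, h01.2]
    · simp [(hkv (T v)).2.2.1, hq, (hTv v).2.2.1]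
    · simp [(hkv (T v)).2.2.2, hq, (hTv v).2.2.2]
  -- the compact label set `S` and uniform continuity of `k`, `Dk` on it
  set S : Set E4 := {p : E4 | p 0 ^ 2 + p 1 ^ 2 ≤ (R₁⁻¹ / 2) ^ 2 ∧
    p 2 ^ 2 + p 3 ^ 2 ≤ (R₁ + 1) ^ 2} with hS
  have hSC : S ⊆ C₁ := fun p hp => by
    show p 0 ^ 2 + p 1 ^ 2 < R₁⁻¹ ^ 2
    have h1 := hp.1
    have h2 : (R₁⁻¹ / 2) ^ 2 < R₁⁻¹ ^ 2 := by
      have := inv_pos.2 hR₁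
      nlinarith
    exact h1.trans_lt h2
  have hScpt : IsCompact S := by
    refine Metric.isCompact_of_isClosed_isBounded ?_ ?_
    · show IsClosed ({p : E4 | p 0 ^ 2 + p 1 ^ 2 ≤ (R₁⁻¹ / 2) ^ 2} ∩
        {p : E4 | p 2 ^ 2 + p 3 ^ 2 ≤ (R₁ + 1) ^ 2})
      exact (isClosed_le (by fun_prop) continuous_const).inter
        (isClosed_le (by fun_prop) continuous_const)
    · rw [isBounded_iff_forall_norm_le]
      refine ⟨R₁⁻¹ / 2 + (R₁ + 1), fun p hp => ?_⟩
      refine (sq_le_sq₀ (norm_nonneg _) (by positivity)).1 ?_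
      rw [EuclideanSpace.real_norm_sq_eq, Fin.sum_univ_four]
      have := inv_pos.2 hR₁
      nlinarith [hp.1, hp.2]
  have hkS : ContinuousOn k S := hkC.continuousOn.mono hSC
  have hDkS : ContinuousOn (fderiv ℝ k) S :=
    (hkC.continuousOn_fderiv_of_isOpen hC₁o le_rfl).mono hSC
  obtain ⟨Mk₀, hMk₀⟩ := hScpt.exists_bound_of_continuousOn hDkS
  set Mk : ℝ := max Mk₀ 0 with hMk
  have hMk0 : 0 ≤ Mk := le_max_right _ _
  have hMkb : ∀ p ∈ S, ‖fderiv ℝ k p‖ ≤ Mk := fun p hp => (hMk₀ p hp).trans (le_max_left _ _)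
  obtain ⟨δ₁, hδ₁, hk_uc⟩ := Metric.uniformContinuousOn_iff.1
    (hScpt.uniformContinuousOn_of_continuous hkS) ε hε
  obtain ⟨δ₂, hδ₂, hDk_uc⟩ := Metric.uniformContinuousOn_iff.1
    (hScpt.uniformContinuousOn_of_continuous hDkS) (ε / 2) (half_pos hε)
  -- the radius
  set ρ : ℝ := max (max (2 * R₁) 1) (max (δ₁⁻¹ + δ₂⁻¹ + 1) (10 * Mk / ε + 1)) with hρ
  have hρ1 : 1 ≤ ρ := (le_max_right _ _).trans (le_max_left _ _)
  have hρ0 : 0 < ρ := one_pos.trans_le hρ1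
  have hρR : 2 * R₁ ≤ ρ := (le_max_left _ _).trans (le_max_left _ _)
  have hρδ : δ₁⁻¹ + δ₂⁻¹ + 1 ≤ ρ := (le_max_left _ _).trans (le_max_right _ _)
  have hρM : 10 * Mk / ε + 1 ≤ ρ := (le_max_right _ _).trans (le_max_right _ _)
  refine ⟨ρ, hρ0, fun w hw => ?_⟩
  set s : ℝ := w 0 ^ 2 + w 1 ^ 2 with hs
  have hs4 : 4 * R₁ ^ 2 ≤ s := by nlinarith only [hρR, hw, hR₁]
  have hsR : R₁ ^ 2 < s := by nlinarith only [hs4, hR₁]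
  have hspos : 0 < s := (sq_nonneg R₁).trans_lt hsR
  have hsρ : ρ ^ 2 ≤ s := hw
  -- the two points of the cylinder: `p = T w` and its axis projection `p' = ι w`
  set p : E4 := T w with hp
  set p' : E4 := ι w with hp'
  have hpC : p ∈ C₁ := (hTC w hsR).1
  have hp'C : p' ∈ C₁ := by
    show (ι w) 0 ^ 2 + (ι w) 1 ^ 2 < R₁⁻¹ ^ 2
    rw [(hιv w).1, (hιv w).2.1]
    simpa using pow_pos (inv_pos.2 hR₁) 2
  have hp01 : p 0 ^ 2 + p 1 ^ 2 = s⁻¹ := hT01 w hspos.ne'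
  have hdist2 : dist p p' ^ 2 = s⁻¹ := by
    rw [dist_eq_norm, EuclideanSpace.real_norm_sq_eq, Fin.sum_univ_four, ← hp01]
    simp [PiLp.sub_apply, hp, hp', (hTv w).2.2.1, (hTv w).2.2.2, (hιv w).1, (hιv w).2.1,
      (hιv w).2.2.1, (hιv w).2.2.2]
  have hdistρ : dist p p' ≤ ρ⁻¹ := by
    refine (sq_le_sq₀ dist_nonneg (by positivity)).1 ?_
    rw [hdist2, inv_pow]
    exact inv_anti₀ (by positivity) hsρ
  have hδ₁ρ : ρ⁻¹ < δ₁ := by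
    have h1 : δ₁⁻¹ < ρ := by
      have := inv_pos.2 hδ₂
      linarith
    exact (inv_lt_comm₀ hρ0 hδ₁).2 h1 |> fun h => h
  have hδ₂ρ : ρ⁻¹ < δ₂ := by
    have h1 : δ₂⁻¹ < ρ := by
      have := inv_pos.2 hδ₁
      linarith
    exact (inv_lt_comm₀ hρ0 hδ₂).2 h1
  have hd₁ : dist p p' < δ₁ := hdistρ.trans_lt hδ₁ρ
  have hd₂ : dist p p' < δ₂ := hdistρ.trans_lt hδ₂ρ
  have hpS_of : w 2 ^ 2 + w 3 ^ 2 ≤ (R₁ + 1) ^ 2 → p ∈ S := fun hz => by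
    refine ⟨?_, ?_⟩
    · show p 0 ^ 2 + p 1 ^ 2 ≤ (R₁⁻¹ / 2) ^ 2
      rw [hp01, div_pow, inv_pow]
      rw [show (R₁ ^ 2)⁻¹ / 2 ^ 2 = (4 * R₁ ^ 2)⁻¹ by ring]
      exact inv_anti₀ (by positivity) hs4
    · show p 2 ^ 2 + p 3 ^ 2 ≤ (R₁ + 1) ^ 2
      rw [hp, (hTv w).2.2.1, (hTv w).2.2.2]
      exact hz
  have hp'S_of : w 2 ^ 2 + w 3 ^ 2 ≤ (R₁ + 1) ^ 2 → p' ∈ S := fun hz => by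
    refine ⟨?_, ?_⟩
    · show p' 0 ^ 2 + p' 1 ^ 2 ≤ (R₁⁻¹ / 2) ^ 2
      rw [hp', (hιv w).1, (hιv w).2.1]
      simpa using sq_nonneg (R₁⁻¹ / 2)
    · show p' 2 ^ 2 + p' 3 ^ 2 ≤ (R₁ + 1) ^ 2
      rw [hp', (hιv w).2.2.1, (hιv w).2.2.2]
      exact hz
  -- derivatives: `T` at `w`, `k` at `p` and `p'`
  obtain ⟨T', hT'd, hT'b⟩ := hasFDerivAt_invFirst ι hι w hspos.ne'
  have hkp : DifferentiableAt ℝ k p :=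
    (hkC.differentiableOn one_ne_zero p hpC).differentiableAt (hC₁o.mem_nhds hpC)
  have hkp' : DifferentiableAt ℝ k p' :=
    (hkC.differentiableOn one_ne_zero p' hp'C).differentiableAt (hC₁o.mem_nhds hp'C)
  have hGd : HasFDerivAt G (ContinuousLinearMap.id ℝ E4 + (fderiv ℝ k p).comp T') w := by
    have h1 : HasFDerivAt (fun v : E4 => v + k (T v))
        (ContinuousLinearMap.id ℝ E4 + (fderiv ℝ k p).comp T') w :=
      (hasFDerivAt_id w).add (hkp.hasFDerivAt.comp w hT'd)
    refine h1.congr_of_eventuallyEq ?_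
    have hU : IsOpen {v : E4 | R₁ ^ 2 < v 0 ^ 2 + v 1 ^ 2} :=
      isOpen_lt continuous_const (by fun_prop)
    filter_upwards [hU.mem_nhds hsR] with v hv
    exact hGk v hv
  have hkι : (fderiv ℝ k p').comp ι = 0 := by
    have h1 : HasFDerivAt (fun v : E4 => k (ι v)) ((fderiv ℝ k p').comp ι) w :=
      hkp'.hasFDerivAt.comp w ι.hasFDerivAt
    have h2 : HasFDerivAt (fun v : E4 => k (ι v)) (0 : E4 →L[ℝ] E4) w := by
      have : (fun v : E4 => k (ι v)) = fun _ => 0 :=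
        funext fun v => hk0 (ι v) (hιv v).1 (hιv v).2.1
      rw [this]
      exact hasFDerivAt_const 0 w
    exact h1.unique h2
  -- in the far region of `z₂` everything vanishes identically
  have hfar0 : (R₁ + 1) ^ 2 < w 2 ^ 2 + w 3 ^ 2 → ∀ q : E4, q ∈ C₁ → q 2 = w 2 → q 3 = w 3 →
      k q = 0 ∧ fderiv ℝ k q = 0 := by
    intro hz q hq hq2 hq3
    have hV : IsOpen (C₁ ∩ {q : E4 | R₁ ^ 2 < q 2 ^ 2 + q 3 ^ 2}) :=
      hC₁o.inter (isOpen_lt continuous_const (by fun_prop))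
    have hqV : q ∈ C₁ ∩ {q : E4 | R₁ ^ 2 < q 2 ^ 2 + q 3 ^ 2} := by
      refine ⟨hq, ?_⟩
      show R₁ ^ 2 < q 2 ^ 2 + q 3 ^ 2
      rw [hq2, hq3]
      nlinarith
    have hev : k =ᶠ[𝓝 q] fun _ => (0 : E4) := by
      filter_upwards [hV.mem_nhds hqV] with q' hq'
      exact hkfar q' hq'.1 hq'.2
    refine ⟨hev.eq_of_nhds, ?_⟩
    rw [hev.fderiv_eq]
    simp
  refine ⟨hGd.differentiableAt, ?_, ?_⟩
  · -- `‖G w - w‖ ≤ ε`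
    rw [hGk w hsR, add_sub_cancel_left]
    by_cases hz : w 2 ^ 2 + w 3 ^ 2 ≤ (R₁ + 1) ^ 2
    · have hpS := hpS_of hz
      have hp'S := hp'S_of hz
      have h := hk_uc p hpS p' hp'S hd₁
      rw [hk0 p' (hιv w).1 (hιv w).2.1, dist_zero_right] at h
      exact h.le
    · rw [(hfar0 (not_le.1 hz) p hpC (hTv w).2.2.1 (hTv w).2.2.2).1, norm_zero]
      exact hε.le
  · -- `‖DG(w) - I‖ ≤ ε`
    rw [hGd.fderiv, add_sub_cancel_left]
    have hsplit : (fderiv ℝ k p).comp T' =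
        (fderiv ℝ k p).comp (T' - ι) + (fderiv ℝ k p - fderiv ℝ k p').comp ι := by
      rw [ContinuousLinearMap.comp_sub, ContinuousLinearMap.sub_comp, hkι]
      abel
    rw [hsplit]
    by_cases hz : w 2 ^ 2 + w 3 ^ 2 ≤ (R₁ + 1) ^ 2
    · have hpS := hpS_of hz
      have hp'S := hp'S_of hz
      have hDk := hDk_uc p hpS p' hp'S hd₂
      rw [dist_eq_norm] at hDk
      have hM10 : Mk * (5 / s) ≤ ε / 2 := by
        rw [mul_div_assoc', div_le_iff₀ hspos]
        have hρρ : ρ ≤ ρ ^ 2 := le_self_pow₀ hρ1 two_ne_zero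
        have h1 : 10 * Mk / ε ≤ s := by linarith only [hρM, hρρ, hsρ]
        have h2 : 10 * Mk ≤ s * ε := by rwa [div_le_iff₀ hε] at h1
        linarith only [h2]
      calc ‖(fderiv ℝ k p).comp (T' - ι) + (fderiv ℝ k p - fderiv ℝ k p').comp ι‖
          ≤ ‖(fderiv ℝ k p).comp (T' - ι)‖ + ‖(fderiv ℝ k p - fderiv ℝ k p').comp ι‖ :=
            norm_add_le _ _
        _ ≤ ‖fderiv ℝ k p‖ * ‖T' - ι‖ + ‖fderiv ℝ k p - fderiv ℝ k p'‖ * ‖ι‖ :=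
            add_le_add (ContinuousLinearMap.opNorm_comp_le _ _)
              (ContinuousLinearMap.opNorm_comp_le _ _)
        _ ≤ Mk * (5 / s) + ε / 2 * 1 := by
            gcongr
            · exact hMkb p hpS
        _ ≤ ε / 2 + ε / 2 * 1 := by gcongr
        _ = ε := by ring
    · rw [(hfar0 (not_le.1 hz) p hpC (hTv w).2.2.1 (hTv w).2.2.2).2,
        (hfar0 (not_le.1 hz) p' hp'C (hιv w).2.2.1 (hιv w).2.2.2).2]
      simp only [ContinuousLinearMap.zero_comp, sub_zero, zero_add, norm_zero]
      exact hε.le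

end FlatCutoff

/-- **Registered helper sub-goal `helper_flatCutoffDecayFirstFactor`** (second auxiliary file of
stub `stub_flatCutoff`): the `C¹`-decay at infinity along the first factor, Pi-form of
`FlatCutoff.decay_first_factor`. [folklore] -/
theorem helper_flatCutoffDecayFirstFactor :
    ∀ (R₁ : ℝ), 0 < R₁ →
    ∀ (G : EuclideanSpace ℝ (Fin 4) → EuclideanSpace ℝ (Fin 4))
      (g : EuclideanSpace ℝ (Fin 4) → EuclideanSpace ℝ (Fin 2)),
      ContDiffOn ℝ 1 g {p : EuclideanSpace ℝ (Fin 4) | p 0 ^ 2 + p 1 ^ 2 < R₁⁻¹ ^ 2} →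
      (∀ p q : EuclideanSpace ℝ (Fin 4), p 0 ^ 2 + p 1 ^ 2 < R₁⁻¹ ^ 2 → (p 0 ≠ 0 ∨ p 1 ≠ 0) →
        q = G (WithLp.toLp 2
          ![p 0 / (p 0 ^ 2 + p 1 ^ 2), -(p 1) / (p 0 ^ 2 + p 1 ^ 2), p 2, p 3]) →
        g p = WithLp.toLp 2 ![q 2, q 3]) →
      (∀ p : EuclideanSpace ℝ (Fin 4), p 0 = 0 → p 1 = 0 → g p = WithLp.toLp 2 ![p 2, p 3]) →
      (∀ w : EuclideanSpace ℝ (Fin 4), R₁ ^ 2 < w 0 ^ 2 + w 1 ^ 2 →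
        (G w) 0 = w 0 ∧ (G w) 1 = w 1) →
      (∀ w : EuclideanSpace ℝ (Fin 4), R₁ ^ 2 < w 2 ^ 2 + w 3 ^ 2 →
        (G w) 2 = w 2 ∧ (G w) 3 = w 3) →
      ∀ ε : ℝ, 0 < ε → ∃ ρ : ℝ, 0 < ρ ∧
        ∀ w : EuclideanSpace ℝ (Fin 4), ρ ^ 2 ≤ w 0 ^ 2 + w 1 ^ 2 →
          DifferentiableAt ℝ G w ∧ ‖G w - w‖ ≤ ε ∧
            ‖fderiv ℝ G w - ContinuousLinearMap.id ℝ (EuclideanSpace ℝ (Fin 4))‖ ≤ ε :=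
  fun _ hR₁ _ _ hg hgG hg0 hGa hGb => FlatCutoff.decay_first_factor hR₁ hg hgG hg0 hGa hGb

end Summit.SmoothPoincare4.SmoothPoincare4.Theorems.GromovRecognitionRelEnd.CrossCapLaurent

end
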